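import Mathlib
import Summits.Schanuel.Schanuel.Theorems.RootDecomp1EAnchorToolkit
import Literature.Barriers.Schanuel.LargeTranscendenceDegree
import Literature.NumberTheory.Transcendental.PeriodsWave0Proofs

set_option linter.dupNamespace false

/-!
# RootDecomp1E — LEVELS, part 6 (Tower): the tower instance `(1; (1, e, e²))` of the anchored E-based cell is an
instance of a NAMED open conjecture

Port of §6c of the lens-2 round-11 node `Levels.lean` (route-Schanuel-RootDecomp1E, theorem round R11-T; critic VERDICT
2026-08-30T14:25:17Z (1′) made kernel).  INDEPENDENT of parts 1–5 (imports landed modules only), so it can land at any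
point of the R11-T sequence.  Content: the conclusion of the anchored E-based cell (`RootDecomp1ELevelsCells`,
`anchored_at_eTower`) at its certified instance `(1; (1, e, e²))` — «`e^e`, `e^{e²}` not both algebraic over `ℚ(e)`» — is
EQUIVALENT to the `t₂`-clause (`d = ℓ = 2`) of `Literature.Barriers.Schanuel.WaldschmidtConjecture_2_3` at the grid
`x = y = (1, e)` (`eTower_conclusion_iff_conj23_instance`); hence that named OPEN conjecture decides the instance
(`eTower_conclusion_of_conj23`).  Its PROVED part (Theorem 2.9's Moreover clause = Brownawell 1974 / Waldschmidt 1973,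
tree `smallTrdeg_thm_2_9_two_two.schneider_eighth_problem`) decides exactly the sub-case `e^e, e^{e²} ∈ ℚ̄`.
Sources: Nesterenko–Philippon (eds.) LNM 1752 Ch. 14, Conjecture 2.3 and Theorem 2.9; Waldschmidt LNM 402 §7.4
(Théorème 7.4.1, Corollaire 7.4.2); Baker 1975 Theorem 12.2.  All proofs hypothesis-free except the displayed `hW`.
-/

namespace Summit.Schanuel.Schanuel.Theorems.RootDecomp1ELevels

open Complex IntermediateField
open Summit.Schanuel.Schanuel.Theorems.RootDecomp1EAnchor (isAlgebraic_of_mem_adjoin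
  trdeg_adjoin_le_of_isAlgebraic trdeg_adjoin_le_nat exists_nat_eq_of_le_natCast
  isAlgebraic_of_trdeg_sandwich one_le_trdeg_adjoin_singleton)
open Literature.Barriers.Schanuel (WaldschmidtConjecture_2_3 gridField₂)
open Literature.NumberTheory.Transcendental (transcendental_rat_cexp_one)

/-- The pair `(1, e)`, used as both sides `x = y` of a `2 × 2` grid. -/
noncomputable def ePair : Fin 2 → ℂ := ![1, cexp 1]

/-- `(1, e)` is ℚ-linearly independent (Hermite). -/
theorem ePair_linearIndependent : LinearIndependent ℚ ePair := by
  refine LinearIndependent.pair_iff.mpr fun s t hst => ?_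
  have hst' : (s : ℂ) + t * cexp 1 = 0 := by simpa [ePair, Rat.smul_def] using hst
  by_cases ht : t = 0
  · subst ht
    have : (s : ℂ) = 0 := by simpa using hst'
    exact ⟨by exact_mod_cast this, rfl⟩
  · exfalso
    -- then `e = -s/t` would be rational, hence algebraic
    have he : cexp 1 = -(s : ℂ) / t := by
      have htC : (t : ℂ) ≠ 0 := by exact_mod_cast ht
      field_simp
      linear_combination hst'
    refine transcendental_rat_cexp_one ?_
    rw [he]
    exact ((isAlgebraic_algebraMap (s : ℚ)).neg.mul (isAlgebraic_algebraMap (t : ℚ)).inv)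

/-- The generators of the grid field at `x = y = (1, e)` are `1, e` and `e^{1·1} = e`, `e^{1·e} = e^{e·1} = e^e`,
`e^{e·e} = e^{e²}`: all algebraic over `ℚ(e)` as soon as `e^e` and `e^{e²}` are. -/
theorem eGrid_gens_isAlgebraic
    (hee : IsAlgebraic ↥(adjoin ℚ ({cexp 1} : Set ℂ)) (cexp (cexp 1)))
    (hee2 : IsAlgebraic ↥(adjoin ℚ ({cexp 1} : Set ℂ)) (cexp (cexp 1 ^ 2))) :
    ∀ w ∈ Set.range ePair ∪ Set.range ePair ∪ Set.range (fun p : Fin 2 × Fin 2 => cexp (ePair p.1 * ePair p.2)),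
      IsAlgebraic ↥(adjoin ℚ ({cexp 1} : Set ℂ)) w := by
  have heK : cexp 1 ∈ adjoin ℚ ({cexp 1} : Set ℂ) := mem_adjoin_simple_self ℚ (cexp 1)
  have h1 : IsAlgebraic ↥(adjoin ℚ ({cexp 1} : Set ℂ)) (1 : ℂ) := isAlgebraic_one
  rintro w ((⟨i, rfl⟩ | ⟨i, rfl⟩) | ⟨⟨i, j⟩, rfl⟩)
  · fin_cases i
    · simpa [ePair] using h1
    · simpa [ePair] using isAlgebraic_of_mem_adjoin heK
  · fin_cases i
    · simpa [ePair] using h1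
    · simpa [ePair] using isAlgebraic_of_mem_adjoin heK
  · fin_cases i <;> fin_cases j
    · simpa [ePair] using isAlgebraic_of_mem_adjoin heK
    · simpa [ePair] using hee
    · simpa [ePair] using hee
    · simpa [ePair, sq] using hee2

/-- **THE TOWER INSTANCE IS A NAMED CONJECTURE'S INSTANCE** (critic VERDICT 14:25:17Z (1′), made kernel): the anchored
E-based cell's conclusion at `(1; (1, e, e²))` — «`e^e`, `e^{e²}` not both algebraic over `ℚ(e)`» — is EQUIVALENT to
the `t₂`-clause (`d = ℓ = 2`) of Waldschmidt's Conjecture 2.3 at the grid `x = y = (1, e)`: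
`trdeg_ℚ ℚ(x, y, e^{xᵢyⱼ}) = trdeg ℚ(e, e^e, e^{e²}) ≥ 2`.  Its PROVED part (Theorem 2.9's Moreover clause =
Brownawell–Waldschmidt, tree `smallTrdeg_thm_2_9_two_two.schneider_eighth_problem`) decides exactly the sub-case
`e^e, e^{e²} ∈ ℚ̄`; Waldschmidt's Corollaire 7.4.2 (LNM 402 §7.4) does the same for every `(r; (r, e^r, e^{2r}))`,
`r ∈ ℚˣ`. [cite: NesterenkoPhilippon2001, Ch. 14 Conjecture 2.3 and Theorem 2.9] -/
theorem eTower_conclusion_iff_conj23_instance :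
    ¬ (IsAlgebraic ↥(adjoin ℚ ({cexp 1} : Set ℂ)) (cexp (cexp 1)) ∧
        IsAlgebraic ↥(adjoin ℚ ({cexp 1} : Set ℂ)) (cexp (cexp 1 ^ 2))) ↔
      (2 : Cardinal) ≤ Algebra.trdeg ℚ ↥(gridField₂ ePair ePair) := by
  -- the grid field is `adjoin ℚ T` for the displayed generating set
  set T : Set ℂ := Set.range ePair ∪ Set.range ePair ∪
    Set.range (fun p : Fin 2 × Fin 2 => cexp (ePair p.1 * ePair p.2)) with hT
  have hG : gridField₂ ePair ePair = adjoin ℚ T := rfl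
  have hKle : Algebra.trdeg ℚ ↥(adjoin ℚ ({cexp 1} : Set ℂ)) ≤ ((1 : ℕ) : Cardinal) :=
    trdeg_adjoin_le_nat _ (by simp)
  have hKge : ((1 : ℕ) : Cardinal) ≤ Algebra.trdeg ℚ ↥(adjoin ℚ ({cexp 1} : Set ℂ)) :=
    one_le_trdeg_adjoin_singleton fun h => transcendental_rat_cexp_one h
  have hST : ({cexp 1} : Set ℂ) ⊆ T := by
    rintro w rfl
    exact Or.inl (Or.inl ⟨1, by simp [ePair]⟩)
  -- a natural value for `trdeg (adjoin ℚ T)` (at most `8` generators)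
  have hTfin : Algebra.trdeg ℚ ↥(adjoin ℚ T) ≤ ((8 : ℕ) : Cardinal) := by
    refine trdeg_adjoin_le_nat _ ?_
    refine (Cardinal.mk_union_le _ _).trans ?_
    refine (add_le_add (Cardinal.mk_union_le _ _) le_rfl).trans ?_
    have h2 : Cardinal.mk ↥(Set.range ePair) ≤ 2 := by simpa using Cardinal.mk_range_le (f := ePair)
    have h4 : Cardinal.mk ↥(Set.range (fun p : Fin 2 × Fin 2 => cexp (ePair p.1 * ePair p.2))) ≤ 4 := by
      simpa using Cardinal.mk_range_le (f := fun p : Fin 2 × Fin 2 => cexp (ePair p.1 * ePair p.2))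
    calc Cardinal.mk ↥(Set.range ePair) + Cardinal.mk ↥(Set.range ePair)
          + Cardinal.mk ↥(Set.range (fun p : Fin 2 × Fin 2 => cexp (ePair p.1 * ePair p.2)))
        ≤ 2 + 2 + 4 := add_le_add (add_le_add h2 h2) h4
      _ = ((8 : ℕ) : Cardinal) := by norm_num
  obtain ⟨t, ht, _⟩ := exists_nat_eq_of_le_natCast hTfin
  rw [hG, ht]
  constructor
  · intro h
    by_contra hlt
    have ht1 : t ≤ 1 := by
      have : ¬ (2 : ℕ) ≤ t := fun h' => hlt (by exact_mod_cast h')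
      omega
    have hTle : Algebra.trdeg ℚ ↥(adjoin ℚ T) ≤ ((1 : ℕ) : Cardinal) := by rw [ht]; exact_mod_cast ht1
    have halg : ∀ w ∈ adjoin ℚ T, IsAlgebraic ↥(adjoin ℚ ({cexp 1} : Set ℂ)) w := fun w hw =>
      isAlgebraic_of_trdeg_sandwich hw hST hTle hKge
    refine h ⟨halg _ (subset_adjoin ℚ _ (Or.inr ⟨(0, 1), by simp [ePair]⟩)),
      halg _ (subset_adjoin ℚ _ (Or.inr ⟨(1, 1), by simp [ePair, sq]⟩))⟩
  · rintro h2 ⟨hee, hee2⟩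
    have hle : Algebra.trdeg ℚ ↥(adjoin ℚ T) ≤ ((1 : ℕ) : Cardinal) :=
      (trdeg_adjoin_le_of_isAlgebraic (eGrid_gens_isAlgebraic hee hee2)).trans hKle
    rw [ht] at hle
    have : (2 : ℕ) ≤ t := by exact_mod_cast h2
    have : t ≤ 1 := by exact_mod_cast hle
    omega

/-- Hence the NAMED OPEN conjecture `WaldschmidtConjecture_2_3` (registered `@[conjecture]` in the tree, OPEN;
`waldschmidtConjecture_2_3_of_schanuel` proved there) DECIDES the tower instance of the anchored E-based cell. -/
theorem eTower_conclusion_of_conj23 (hW : WaldschmidtConjecture_2_3) :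
    ¬ (IsAlgebraic ↥(adjoin ℚ ({cexp 1} : Set ℂ)) (cexp (cexp 1)) ∧
        IsAlgebraic ↥(adjoin ℚ ({cexp 1} : Set ℂ)) (cexp (cexp 1 ^ 2))) := by
  have h := (hW 2 2 ePair ePair ePair_linearIndependent ePair_linearIndependent le_rfl le_rfl).2.2
  norm_num at h
  exact eTower_conclusion_iff_conj23_instance.mpr h

end Summit.Schanuel.Schanuel.Theorems.RootDecomp1ELevels
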